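import Literature.NumberTheory.EllipticCurves.ModularCurveKleinJ
import Literature.NumberTheory.EllipticCurves.HeegnerPoints
import Literature.NumberTheory.QuadraticFields.BinaryQuadraticFormsClassNumber
import Literature.Barriers.RiemannHypothesis.EpsteinZetaRealZeros
import Literature.NumberTheory.EllipticCurves.ComplexMultiplicationSingularModuli
import Mathlib.NumberTheory.LegendreSymbol.JacobiSymbol
import Mathlib.Tactic.NormNum.LegendreSymbol
import HarnessLib

/-!
# Gross–Zagier, *On singular moduli* (1985), Theorem 1.3: the factorisation of `J(d₁, d₂)`

Topic `NumberTheory/EllipticCurves` (singular moduli, next to `ComplexMultiplicationSingularModuli`,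
`SingularModuliIntegralCM`, `HeegnerPoints`). Statement-level typing (one NAMED FACT, everything else
definitions with bodies and proved API) of the theorem of B. H. Gross and D. B. Zagier on the prime
factorisation of the difference of two singular moduli, in the form in which it is restated
by Lauter–Viray (IMRN 2015 = arXiv:1206.6942, §1, "Theorem [GZ-SingularModuli]"; verbatim except for
the index condition of the product — see the note "Index condition" below):

> Let `d₁` and `d₂` be two relatively prime fundamental discriminants of imaginary quadratic fields.
> For any prime `p` dividing a positive integer of the form `d₁d₂ − x²`, choose `i` such that
> `p ∤ dᵢ` and define `ε(p) = (dᵢ/p)`, and extend the definition of `ε` by multiplicativity. Then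
> `J(d₁, d₂)^{8/(w₁w₂)} = ± ∏_{x² < d₁d₂, x ≡ d₁d₂ (mod 2)} F((d₁d₂ − x²)/4)`
> where `F(m) = ∏_{n ∣ m, n > 0} n^{ε(m/n)}` and `wᵢ` denotes the number of roots of unity in the
> quadratic imaginary order of discriminant `dᵢ`,

with `J(d₁, d₂) = ∏_{[τ₁], [τ₂]} (j(τ₁) − j(τ₂))`, the product over the `SL₂(ℤ)`-classes of points
of the upper half-plane of discriminants `d₁`, `d₂`. (The primary source, J. reine angew. Math. 355,
is not held by the tree's library at the time of writing — acquisition request acq-03341; the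
statement and the theorem number are taken from the secondary literature, the display from
Lauter–Viray §1, whose `J` is the plain double product, with the index condition `x² < d₁d₂` of
Cox Thm. 13.24 / Lauter–Viray Thm. 1.1 — see the next paragraph.)

Index condition. Lauter–Viray's display of [GZ-SingularModuli] prints the range of the product as
`x ∈ ℤ, |x| < d₁d₂, x ≡ d₁d₂ (mod 2)` (arXiv:1206.6942, p. 3). The condition of Gross–Zagier's
theorem as printed by Cox, *Primes of the form x² + ny²*, 2nd ed., Thm. 13.24 (`x² < d₁d₂,
x² ≡ d₁d₂ mod 4`; the primary source being unheld, acq-03341), and the one Lauter–Viray themselves use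
in their Theorem 1.1 on the same page, is `x² < d₁d₂` — the only reading under which every factor
`F((d₁d₂ − x²)/4)` has a positive integer argument. This file uses `x² < d₁d₂`
(`GrossZagier1985.xRange`); the two index sets differ exactly by the `x` with `d₁d₂ ≤ x² < (d₁d₂)²`, for
which `(d₁d₂ − x²)/4 ≤ 0` and `F` is not defined in the sources. (For `d₁d₂ ≡ x² (mod 4)`-type
bookkeeping: `x ≡ d₁d₂ (mod 2)` and `x² ≡ d₁d₂ (mod 4)` are equivalent, since `d₁d₂ ≡ 0, 1 (mod 4)`.)

## How it is typed (tree vocabulary only; nothing is re-declared)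

* the classes `[τ]` of discriminant `d < 0` are the reduced primitive positive definite forms
  `Quadratic.BinQF.reducedFormsList d` (Cox Thm. 2.8/2.13, file `QuadraticFields/BinaryQuadraticFormsClassNumber`),
  each contributing its CM point `heegnerTau (a, b, c) = (−b + √d)/(2a)` (file `HeegnerPoints`) and the
  singular modulus `kleinJ (heegnerTau …)` (Klein's `j = E₄³/Δ`, file `ModularCurveKleinJ`) —
  `GrossZagier1985.formTau`, `GrossZagier1985.J`;
* "fundamental discriminant" is the tree's `IsFundamentalDiscriminant`
  (`d ≡ 1 (4)` square-free, or `d = 4m`, `m ≡ 2, 3 (4)` square-free);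
* `ε` at a prime is the Kronecker symbol `(dᵢ/p)` of the `dᵢ` not divisible by `p` — Mathlib's
  `jacobiSym` at odd `p`, and at `p = 2` the values `1, −1, 0` for `d ≡ ±1, ±3 (mod 8)`, `d` even
  (Cox §1.C (1.18), the convention of the tree's `exists_kroneckerChar`) — and `ε(n)` is its completely
  multiplicative extension `∏_{p^k ∥ n} ε(p)^k` (`GrossZagier1985.epsPrime`, `GrossZagier1985.eps`);
  `F` and the finite product over `x` are `GrossZagier1985.F`, `GrossZagier1985.rhs` (values in `ℚ`);
* the printed identity involves the fractional power `J^{8/(w₁w₂)}` (`w₁w₂ ∈ {4, 8, 12, 16, 24}`) and a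
  sign. The fact records its sign-free integral-power CONSEQUENCE
  `J(d₁,d₂)^8 = (∏ₓ F((d₁d₂ − x²)/4))^{w₁w₂}` (raise the printed identity to the even power `w₁w₂`),
  which is what a computation checks; nothing stronger than print is asserted.

The fact is NOT proved here (Gross–Zagier's proof: Deuring liftings and the counting of
isomorphisms `Isom_{W/πⁿ}(E₁, E₂)` through the endomorphism rings `𝒪 + πⁿ⁻¹𝒪_B`; or analytically via
the derivative of an Eisenstein series). Proved API: `unitCount` values, the unfolding of `J` for
`d₁ = −4` through `kleinJ_I = 1728` (`BinQF.reducedFormsList (−4) = [(1,0,1)]`, `formTau (1,0,1) = i`),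
the values `ε(1)`, `ε(p)`, `F(1)`, `F(q)`, and the worked instance `(d₁, d₂) = (−4, −7)` below.

## References

* [GrossZagier1985SingularModuli] B. H. Gross, D. B. Zagier, *On singular moduli*, J. reine angew.
  Math. 355 (1985) 191–220, Theorem 1.3 (and Cor. 1.6).
* [LauterViray2015SingularModuli] K. Lauter, B. Viray, *On singular moduli for arbitrary
  discriminants*, IMRN 2015 (19) 9206–9250 = arXiv:1206.6942, §1 (restatement used here — verbatim
  up to its printed index condition `|x| < d₁d₂`, for which `x² < d₁d₂` (Cox Thm. 13.24) is used, see
  "Index condition" above; their Thm. 1.1 / Conj. 1.7 generalise it to arbitrary discriminants).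
* [Cox2013] D. A. Cox, *Primes of the form x² + ny²*, 2nd ed., §1.C (1.18) (Kronecker symbol),
  Thm. 2.8/2.13 (reduced forms), Thm. 13.24 (the Gross–Zagier formula, index condition
  `x² < d₁d₂, x² ≡ d₁d₂ mod 4`).
-/

noncomputable section

open scoped NumberTheorySymbols

namespace Literature.NumberTheory.EllipticCurves

namespace GrossZagier1985

open Literature.NumberTheory.QuadraticFields.Quadratic
open Literature.NumberTheory.EllipticCurves.ModularForms
open Literature.Barriers.RiemannHypothesis (IsFundamentalDiscriminant)

/-! ### The arithmetic functions `w`, `ε`, `F` -/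

/-- `w(d)`, the number of roots of unity in the imaginary quadratic order of discriminant `d < 0`:
`6` for `d = −3`, `4` for `d = −4`, and `2` otherwise ("`wᵢ` denotes the number of roots of unity in
the quadratic imaginary order of discriminant `dᵢ`"). [cite: LauterViray2015SingularModuli, §1 (Theorem [GZ])] -/
def unitCount (d : ℤ) : ℕ :=
  if d = -3 then 6 else if d = -4 then 4 else 2

/-- `w(−3) = 6` (the six units of `ℤ[ρ]`). [cite: LauterViray2015SingularModuli, §1 (Theorem [GZ], definition of wᵢ)] -/
@[simp] theorem unitCount_neg_three : unitCount (-3) = 6 := by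
  simp [unitCount]

/-- `w(−4) = 4` (the four units of `ℤ[i]`). [cite: LauterViray2015SingularModuli, §1 (Theorem [GZ], definition of wᵢ)] -/
@[simp] theorem unitCount_neg_four : unitCount (-4) = 4 := by
  simp [unitCount]

/-- `w(d) = 2` for `d ≠ −3, −4` (in particular for every discriminant `d < −4`: units `±1`).
[cite: LauterViray2015SingularModuli, §1 (Theorem [GZ], definition of wᵢ)] -/
theorem unitCount_of_ne {d : ℤ} (h3 : d ≠ -3) (h4 : d ≠ -4) : unitCount d = 2 := by
  simp [unitCount, h3, h4]

/-- The Kronecker symbol `(d/p)` at a prime `p`: the Legendre/Jacobi symbol for odd `p`, and at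
`p = 2` the value `0` if `d` is even, `1` if `d ≡ ±1 (mod 8)`, `−1` if `d ≡ ±3 (mod 8)`
(Cox, §1.C (1.18); the convention of the tree's `exists_kroneckerChar`). Only its values at primes
are used below. [cite: Cox2013, §1.C (1.18)] -/
def kroneckerPrime (d : ℤ) (p : ℕ) : ℤ :=
  if p = 2 then (if (2 : ℤ) ∣ d then 0 else if d % 8 = 1 ∨ d % 8 = 7 then 1 else -1)
  else J(d | p)

/-- Gross–Zagier's `ε` at a prime `p`: "choose `i` such that `p ∤ dᵢ` and define `ε(p) = (dᵢ/p)`" —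
here `i = 1` unless `p ∣ d₁`, in which case `i = 2` (for coprime `d₁, d₂` and `p ∣ d₁d₂ − x²` the
choice is immaterial, as the source's phrasing presupposes). [cite: GrossZagier1985SingularModuli, Theorem 1.3] -/
def epsPrime (d₁ d₂ : ℤ) (p : ℕ) : ℤ :=
  if (p : ℤ) ∣ d₁ then kroneckerPrime d₂ p else kroneckerPrime d₁ p

/-- `ε(n)` for a positive integer `n`: the extension of `ε` "by multiplicativity",
`ε(∏ p^{k_p}) = ∏ ε(p)^{k_p}` (`ε(1) = 1`; `ε(0) = 1` is a junk value never used).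
[cite: GrossZagier1985SingularModuli, Theorem 1.3] -/
def eps (d₁ d₂ : ℤ) (n : ℕ) : ℤ :=
  n.factorization.prod fun p k => epsPrime d₁ d₂ p ^ k

/-- `F(m) = ∏_{n ∣ m, n > 0} n^{ε(m/n)}`, a positive rational number (the exponents are `0, ±1`;
Gross–Zagier show it is a power of a single prime). [cite: GrossZagier1985SingularModuli, Theorem 1.3] -/
def F (d₁ d₂ : ℤ) (m : ℕ) : ℚ :=
  ∏ n ∈ m.divisors, (n : ℚ) ^ eps d₁ d₂ (m / n)

/-! ### `J(d₁, d₂)` and the product over `x` -/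

/-- The CM point `τ_f = (−b + √(b² − 4ac))/(2a) ∈ ℍ` of a positive definite form `f = (a, b, c)` — the
tree's `heegnerTau` on the coefficient triple. [cite: GrossZagier1985SingularModuli, §1] -/
def formTau (f : BinQF) : UpperHalfPlane :=
  heegnerTau (f.a, f.b, f.c)

/-- `J(d₁, d₂) = ∏_{[τ₁], [τ₂]} (j(τ₁) − j(τ₂))`, the product over the `SL₂(ℤ)`-classes of points of
discriminants `d₁`, `d₂`, i.e. over the reduced primitive positive definite forms of these
discriminants (Cox Thm. 2.8: one reduced form per class), of the differences of the singular moduli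
`j(τ) = E₄(τ)³/Δ(τ)`. [cite: GrossZagier1985SingularModuli, §1 (definition of J)] -/
def J (d₁ d₂ : ℤ) : ℂ :=
  ((BinQF.reducedFormsList d₁).map fun f =>
    ((BinQF.reducedFormsList d₂).map fun g => kleinJ (formTau f) - kleinJ (formTau g)).prod).prod

/-- The index set of the product: integers `x` with `x² < d₁d₂` and `x ≡ d₁d₂ (mod 2)` (so that
`(d₁d₂ − x²)/4` is a positive integer). [cite: GrossZagier1985SingularModuli, Theorem 1.3] -/
def xRange (d₁ d₂ : ℤ) : Finset ℤ :=
  (Finset.Icc (-(d₁ * d₂)) (d₁ * d₂)).filter fun x => x ^ 2 < d₁ * d₂ ∧ x % 2 = (d₁ * d₂) % 2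

/-- The right-hand side `∏_{x² < d₁d₂, x ≡ d₁d₂ (2)} F((d₁d₂ − x²)/4) ∈ ℚ`.
[cite: GrossZagier1985SingularModuli, Theorem 1.3] -/
def rhs (d₁ d₂ : ℤ) : ℚ :=
  ∏ x ∈ xRange d₁ d₂, F d₁ d₂ ((d₁ * d₂ - x ^ 2) / 4).toNat

end GrossZagier1985

open GrossZagier1985 Literature.Barriers.RiemannHypothesis in
/-- **Gross–Zagier 1985, Theorem 1.3 (factorisation of the difference of singular moduli)**, as
restated by Lauter–Viray §1 (verbatim except that their display prints the index condition of the
product as `|x| < d₁d₂`; the condition below, `x² < d₁d₂`, is that of Cox Thm. 13.24 and of Lauter–Viray's own Thm. 1.1 —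
see "Index condition" in the module docstring): for two relatively prime fundamental discriminants
`d₁, d₂ < 0` of imaginary quadratic fields, with `ε(p) = (dᵢ/p)` for the `dᵢ` prime to `p`, extended
multiplicatively, `F(m) = ∏_{n∣m} n^{ε(m/n)}` and `wᵢ` the number of roots of unity of the order of
discriminant `dᵢ`,
`J(d₁, d₂)^{8/(w₁w₂)} = ± ∏_{x² < d₁d₂, x ≡ d₁d₂ (mod 2)} F((d₁d₂ − x²)/4)`.
Recorded in the equivalent-up-to-sign integral-power form obtained by raising both sides to the even
power `w₁w₂`: `J(d₁,d₂)^8 = (∏ₓ F(…))^{w₁w₂}` in `ℂ` (the right-hand side a rational number). NOT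
proved here; users take `(h : grossZagier1985_singularModuli)`.
[cite: GrossZagier1985SingularModuli, Theorem 1.3] -/
def grossZagier1985_singularModuli : Prop :=
  ∀ d₁ d₂ : ℤ, d₁ < 0 → d₂ < 0 → IsFundamentalDiscriminant d₁ → IsFundamentalDiscriminant d₂ →
    Int.gcd d₁ d₂ = 1 →
      J d₁ d₂ ^ 8 = ((rhs d₁ d₂ : ℚ) : ℂ) ^ (unitCount d₁ * unitCount d₂)

namespace GrossZagier1985

open Literature.NumberTheory.QuadraticFields.Quadratic
open Literature.NumberTheory.EllipticCurves.ModularForms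

/-! ### Proved API: the case `d₁ = −4` unfolds through `j(i) = 1728` -/

/-- The CM point of `x² + y²` is `i`. [folklore] -/
private theorem formTau_one_zero_one : formTau ⟨1, 0, 1⟩ = UpperHalfPlane.I := by
  apply UpperHalfPlane.ext
  rw [formTau, coe_heegnerTau (by norm_num) (by norm_num)]
  apply Complex.ext
  · simp
  · have h4 : Real.sqrt 4 = 2 := by
      rw [show (4 : ℝ) = 2 ^ 2 by norm_num, Real.sqrt_sq (by norm_num : (0 : ℝ) ≤ 2)]
    simp [h4]

/-- For `d₁ = −4` the product `J(−4, d₂)` is `∏_{[τ₂]} (1728 − j(τ₂))` (`j(i) = 1728`,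
`kleinJ_I`). [cite: GrossZagier1985SingularModuli, §1] -/
theorem J_neg_four (d₂ : ℤ) :
    J (-4) d₂ = ((BinQF.reducedFormsList d₂).map fun g => (1728 : ℂ) - kleinJ (formTau g)).prod := by
  -- `BinQF.reducedFormsList (-4) = [(1,0,1)]` is `ComplexTorus.reducedFormsList_neg_four` of
  -- `Geometry/Kaehler/ComplexTorusEllipticCurveCMClassNumber` (not imported: Kähler geometry); by `decide`
  have h4 : BinQF.reducedFormsList (-4) = [⟨1, 0, 1⟩] := by decide
  simp [J, h4, formTau_one_zero_one, kleinJ_I]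

/-! ### Elementary evaluations of `ε`, `F` and of the product over `x` -/

/-- `ε(1) = 1` (empty product). [cite: GrossZagier1985SingularModuli, Theorem 1.3 (definition of ε)] -/
@[simp] theorem eps_one (d₁ d₂ : ℤ) : eps d₁ d₂ 1 = 1 := by
  simp [eps]

/-- At a prime `p`, the multiplicative extension `ε` takes the value `ε(p)`.
[cite: GrossZagier1985SingularModuli, Theorem 1.3 (definition of ε)] -/
theorem eps_prime (d₁ d₂ : ℤ) {p : ℕ} (hp : p.Prime) : eps d₁ d₂ p = epsPrime d₁ d₂ p := by
  simp [eps, hp.factorization, Finsupp.prod_single_index]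

/-- `F(1) = 1^{ε(1)} = 1`. [cite: GrossZagier1985SingularModuli, Theorem 1.3 (definition of F)] -/
@[simp] theorem F_one (d₁ d₂ : ℤ) : F d₁ d₂ 1 = 1 := by
  simp [F]

/-- For a prime `q`, `F(q) = 1^{ε(q)} · q^{ε(1)} = q`.
[cite: GrossZagier1985SingularModuli, Theorem 1.3 (definition of F)] -/
theorem F_prime (d₁ d₂ : ℤ) {q : ℕ} (hq : q.Prime) : F d₁ d₂ q = q := by
  rw [F, hq.divisors, Finset.prod_pair hq.one_lt.ne]
  simp [Nat.div_self hq.pos]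

/-! ### The worked example `(d₁, d₂) = (−4, −7)`: `12³ + 15³ = 5103 = 3⁶ · 7`

With `ε(2) = (−7/2) = 1` (`−7 ≡ 1 (mod 8)`), `ε(3) = (−4/3) = −1`, `ε(7) = (−4/7) = −1`:
`F(7) = 7`, `F(6) = 2^{ε(3)} 3^{ε(2)} 6 = 9`, `F(3) = 3`, the `x`-range is `{0, ±2, ±4}`
(`(28 − x²)/4 = 7, 6, 3`), so `∏ₓ F = 3 · 9 · 7 · 9 · 3 = 5103 = 1728 + 3375 = j(i) − j((1+√−7)/2)`,
`w₁w₂ = 4 · 2 = 8`, and the theorem reads `J(−4,−7)^8 = 5103^8` — an instance PROVED below from the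
tree's table of class-number-one singular moduli (`singularModuli_classNumberOne`). -/

/-- `ε(3) = (−4/3) = −1` for `(d₁, d₂) = (−4, −7)`. [folklore] -/
private theorem eps_neg_four_neg_seven_three : eps (-4) (-7) 3 = -1 := by
  rw [eps_prime _ _ Nat.prime_three, epsPrime, if_neg (by decide), kroneckerPrime, if_neg (by decide)]
  norm_num

/-- `ε(2) = (−7/2) = 1` for `(d₁, d₂) = (−4, −7)` (`2 ∣ d₁`, `−7 ≡ 1 (mod 8)`). [folklore] -/
private theorem eps_neg_four_neg_seven_two : eps (-4) (-7) 2 = 1 := by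
  rw [eps_prime _ _ Nat.prime_two, epsPrime, if_pos (by decide), kroneckerPrime, if_pos rfl]
  decide

/-- `F(6) = 2^{ε(3)} · 3^{ε(2)} · 6 = 9` for `(d₁, d₂) = (−4, −7)`. [folklore] -/
private theorem F_neg_four_neg_seven_six : F (-4) (-7) 6 = 9 := by
  have hdiv : Nat.divisors 6 = {1, 2, 3, 6} := by decide
  rw [F, hdiv, Finset.prod_insert (by decide), Finset.prod_insert (by decide),
    Finset.prod_pair (by decide)]
  norm_num [eps_neg_four_neg_seven_three, eps_neg_four_neg_seven_two]

/-- The `x`-range for `(−4, −7)`: `x² < 28`, `x` even. [folklore] -/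
private theorem xRange_neg_four_neg_seven : xRange (-4) (-7) = {-4, -2, 0, 2, 4} := by
  decide

/-- The right-hand side of Theorem 1.3 at `(d₁, d₂) = (−4, −7)` evaluates to
`∏ₓ F((28 − x²)/4) = F(3) F(6) F(7) F(6) F(3) = 3 · 9 · 7 · 9 · 3 = 5103 = 3⁶ · 7`
(evaluation of the printed right-hand side; all primes `≤ d₁d₂/4 = 7`).
[cite: GrossZagier1985SingularModuli, Theorem 1.3 (right-hand side at (−4, −7))] -/
theorem rhs_neg_four_neg_seven : rhs (-4) (-7) = 5103 := by
  rw [rhs, xRange_neg_four_neg_seven, Finset.prod_insert (by decide), Finset.prod_insert (by decide),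
    Finset.prod_insert (by decide), Finset.prod_pair (by decide)]
  norm_num
  rw [show (3 : ℤ).toNat = 3 from rfl, show (6 : ℤ).toNat = 6 from rfl, show (7 : ℤ).toNat = 7 from rfl,
    F_neg_four_neg_seven_six, F_prime _ _ Nat.prime_three, F_prime _ _ (by norm_num : Nat.Prime 7)]
  norm_num

/-! ### The instance `(d₁, d₂) = (−4, −7)` from the table of singular moduli -/

/-- The only reduced form of discriminant `−7` is `x² + xy + 2y²`. [cite: Cox2013, Thm. 2.13] -/
theorem reducedFormsList_neg_seven : BinQF.reducedFormsList (-7) = [⟨1, 1, 2⟩] := by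
  decide

/-- `ω_{−7} = (−7 + √−7)/2` is the translate by `−3` of the CM point `(−1 + √−7)/2` of
`x² + xy + 2y²`. [folklore] -/
private theorem sl2z_smul_formTau_neg_seven :
    sl2zMk 1 (-3) 0 1 (by norm_num) • formTau ⟨1, 1, 2⟩ = cmTau (-7) := by
  apply UpperHalfPlane.ext
  rw [coe_sl2zMk_smul, coe_cmTau (by norm_num), formTau, coe_heegnerTau (by norm_num) (by norm_num),
    cmGen]
  have h7 : ((4 : ℝ) * (1 : ℤ) * (2 : ℤ) - (1 : ℤ) ^ 2) = 7 := by norm_num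
  have h7' : (-((-7 : ℤ) : ℝ)) = 7 := by norm_num
  rw [h7, h7']
  apply Complex.ext
  · simp
    ring
  · simp

/-- **`j((1 + √−7)/2) = −3375 = −15³`** at the CM point of `x² + xy + 2y²`, from the tree's table of
singular moduli of the class-number-one maximal orders (`singularModuli_classNumberOne`, row
`d = −7`). [cite: Cox2013, §12.C (12.20)] -/
theorem kleinJ_formTau_neg_seven (h : singularModuli_classNumberOne) :
    kleinJ (formTau ⟨1, 1, 2⟩) = -3375 := by
  have hmem : (-3375 : ℚ) ∈ maximalCMJInvariants := by simp [maximalCMJInvariants]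
  have hrow := h _ hmem
  have hd : cmDiscr (-3375) = -7 := by norm_num [cmDiscr]
  rw [hd, cmPeriodPair, ← kleinJ_eq_periodPair_j, ← sl2z_smul_formTau_neg_seven, kleinJ_smul] at hrow
  rw [hrow]
  push_cast
  ring

/-- `J(−4, −7) = j(i) − j((1+√−7)/2) = 1728 + 3375 = 5103`, from the singular-moduli table.
[cite: GrossZagier1985SingularModuli, Theorem 1.3] -/
theorem J_neg_four_neg_seven (h : singularModuli_classNumberOne) : J (-4) (-7) = 5103 := by
  rw [J_neg_four, reducedFormsList_neg_seven]
  simp [kleinJ_formTau_neg_seven h]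
  norm_num

/-- **Gross–Zagier Theorem 1.3 at `(d₁, d₂) = (−4, −7)`**: `J(−4,−7)^8 = (∏ₓ F)^{w₁w₂}`, i.e.
`5103^8 = 5103^8` — the classical `12³ + 15³ = 3⁶·7` — PROVED from the class-number-one singular
moduli. [cite: GrossZagier1985SingularModuli, Theorem 1.3] -/
theorem grossZagier1985_neg_four_neg_seven (h : singularModuli_classNumberOne) :
    J (-4) (-7) ^ 8 = ((rhs (-4) (-7) : ℚ) : ℂ) ^ (unitCount (-4) * unitCount (-7)) := by
  rw [J_neg_four_neg_seven h, rhs_neg_four_neg_seven, unitCount_neg_four,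
    unitCount_of_ne (by norm_num) (by norm_num)]
  norm_num

/-! ### The unconditional instance `(d₁, d₂) = (−3, −4)`: `J(−3,−4) = j(ρ) − j(i) = −1728`, `w₁w₂ = 24`,
`∏ₓ F = F(3) F(2)² = 12`, and `(−1728)^8 = 12^{24}` -/

/-- The CM point of `x² + xy + y²` is `ρ = (−1 + √−3)/2`. [folklore] -/
private theorem formTau_one_one_one : formTau ⟨1, 1, 1⟩ = UpperHalfPlane.ρ := by
  apply UpperHalfPlane.ext
  rw [formTau, coe_heegnerTau (by norm_num) (by norm_num)]
  apply Complex.ext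
  · simp [UpperHalfPlane.ρ]
  · simp [UpperHalfPlane.ρ]
    norm_num

/-- `J(−3, −4) = j(ρ) − j(i) = 0 − 1728` (`kleinJ_rho`, `kleinJ_I`; one reduced form each,
`x² + xy + y²` and `x² + y²`). [cite: GrossZagier1985SingularModuli, Theorem 1.3] -/
theorem J_neg_three_neg_four : J (-3) (-4) = -1728 := by
  have h3 : BinQF.reducedFormsList (-3) = [⟨1, 1, 1⟩] := by decide
  have h4 : BinQF.reducedFormsList (-4) = [⟨1, 0, 1⟩] := by decide
  simp [J, h3, h4, formTau_one_one_one, formTau_one_zero_one, kleinJ_I, kleinJ_rho]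

/-- `ε(3) = (−4/3) = −1` for `(d₁, d₂) = (−3, −4)` (`3 ∣ d₁`, so `i = 2`). [folklore] -/
private theorem eps_neg_three_neg_four_three : eps (-3) (-4) 3 = -1 := by
  rw [eps_prime _ _ Nat.prime_three, epsPrime, if_pos (by decide), kroneckerPrime, if_neg (by decide)]
  norm_num

/-- `ε(2) = (−3/2) = −1` for `(d₁, d₂) = (−3, −4)` (`−3 ≡ 5 (mod 8)`). [folklore] -/
private theorem eps_neg_three_neg_four_two : eps (-3) (-4) 2 = -1 := by
  rw [eps_prime _ _ Nat.prime_two, epsPrime, if_neg (by decide), kroneckerPrime, if_pos rfl]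
  decide

/-- The `x`-range for `(−3, −4)`: `x² < 12`, `x` even. [folklore] -/
private theorem xRange_neg_three_neg_four : xRange (-3) (-4) = {-2, 0, 2} := by
  decide

/-- The right-hand side of Theorem 1.3 at `(d₁, d₂) = (−3, −4)`:
`∏ₓ F((12 − x²)/4) = F(2) F(3) F(2) = 2 · 3 · 2 = 12` (evaluation of the printed right-hand side).
[cite: GrossZagier1985SingularModuli, Theorem 1.3 (right-hand side at (−3, −4))] -/
theorem rhs_neg_three_neg_four : rhs (-3) (-4) = 12 := by
  rw [rhs, xRange_neg_three_neg_four, Finset.prod_insert (by decide), Finset.prod_pair (by decide)]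
  norm_num
  rw [show (2 : ℤ).toNat = 2 from rfl, show (3 : ℤ).toNat = 3 from rfl,
    F_prime _ _ Nat.prime_two, F_prime _ _ Nat.prime_three]
  norm_num

/-- **Gross–Zagier Theorem 1.3 at `(d₁, d₂) = (−3, −4)`, UNCONDITIONALLY**: `J(−3,−4)^8 = (∏ₓ F)^{w₁w₂}`,
i.e. `(j(ρ) − j(i))^8 = 1728^8 = 12^{24}` — both singular moduli are theorems of the tree
(`kleinJ_rho = 0`, `kleinJ_I = 1728`). [cite: GrossZagier1985SingularModuli, Theorem 1.3] -/
theorem grossZagier1985_neg_three_neg_four :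
    J (-3) (-4) ^ 8 = ((rhs (-3) (-4) : ℚ) : ℂ) ^ (unitCount (-3) * unitCount (-4)) := by
  rw [J_neg_three_neg_four, rhs_neg_three_neg_four, unitCount_neg_three, unitCount_neg_four]
  norm_num

/-! ### The instance `(d₁, d₂) = (−3, −7)` from the table: `J = j(ρ) − j((1+√−7)/2) = 3375 = 15³`,
`w₁w₂ = 12`, `∏ₓ F = F(5)² F(3)² = 225`, `3375^8 = 225^{12} = 15^{24}` -/

/-- `J(−3, d₂) = ∏_{[τ₂]} (0 − j(τ₂))` (`j(ρ) = 0`). [cite: GrossZagier1985SingularModuli, §1] -/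
theorem J_neg_three (d₂ : ℤ) :
    J (-3) d₂ = ((BinQF.reducedFormsList d₂).map fun g => -kleinJ (formTau g)).prod := by
  have h3 : BinQF.reducedFormsList (-3) = [⟨1, 1, 1⟩] := by decide
  simp [J, h3, formTau_one_one_one, kleinJ_rho]

/-- `ε(3) = (−7/3) = −1` and `ε(5) = (−3/5) = −1` for `(d₁, d₂) = (−3, −7)`. [folklore] -/
private theorem eps_neg_three_neg_seven :
    eps (-3) (-7) 3 = -1 ∧ eps (-3) (-7) 5 = -1 := by
  refine ⟨?_, ?_⟩
  · rw [eps_prime _ _ Nat.prime_three, epsPrime, if_pos (by decide), kroneckerPrime, if_neg (by decide)]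
    norm_num
  · rw [eps_prime _ _ (by norm_num : Nat.Prime 5), epsPrime, if_neg (by decide), kroneckerPrime,
      if_neg (by decide)]
    norm_num

/-- The `x`-range for `(−3, −7)`: `x² < 21`, `x` odd. [folklore] -/
private theorem xRange_neg_three_neg_seven : xRange (-3) (-7) = {-3, -1, 1, 3} := by
  decide

/-- The right-hand side of Theorem 1.3 at `(d₁, d₂) = (−3, −7)`:
`∏ₓ F((21 − x²)/4) = F(3) F(5) F(5) F(3) = 225 = 15²` (evaluation of the printed right-hand side).
[cite: GrossZagier1985SingularModuli, Theorem 1.3 (right-hand side at (−3, −7))] -/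
theorem rhs_neg_three_neg_seven : rhs (-3) (-7) = 225 := by
  rw [rhs, xRange_neg_three_neg_seven, Finset.prod_insert (by decide), Finset.prod_insert (by decide),
    Finset.prod_pair (by decide)]
  norm_num
  rw [show (3 : ℤ).toNat = 3 from rfl, show (5 : ℤ).toNat = 5 from rfl,
    F_prime _ _ Nat.prime_three, F_prime _ _ (by norm_num : Nat.Prime 5)]
  norm_num

/-- **Gross–Zagier Theorem 1.3 at `(d₁, d₂) = (−3, −7)`**: `J(−3,−7)^8 = 3375^8 = 225^{12} = (∏ₓ F)^{w₁w₂}`,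
from the singular-moduli table (row `d = −7`). [cite: GrossZagier1985SingularModuli, Theorem 1.3] -/
theorem grossZagier1985_neg_three_neg_seven (h : singularModuli_classNumberOne) :
    J (-3) (-7) ^ 8 = ((rhs (-3) (-7) : ℚ) : ℂ) ^ (unitCount (-3) * unitCount (-7)) := by
  rw [J_neg_three, reducedFormsList_neg_seven, rhs_neg_three_neg_seven, unitCount_neg_three,
    unitCount_of_ne (by norm_num) (by norm_num)]
  simp [kleinJ_formTau_neg_seven h]
  norm_num

/-! ### The instance `(d₁, d₂) = (−7, −8)` from the table: `J = j((1+√−7)/2) − j(√−2) = −3375 − 8000`,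
`w₁w₂ = 4`, `∏ₓ F = F(14) F(13)² F(10)² F(5)² = 49 · 169 · 625 · 25 = 11375²` -/

/-- The only reduced form of discriminant `−8` is `x² + 2y²`. [cite: Cox2013, Thm. 2.13] -/
theorem reducedFormsList_neg_eight : BinQF.reducedFormsList (-8) = [⟨1, 0, 2⟩] := by
  decide

/-- `ω_{−8} = (−8 + √−8)/2 = −4 + √−2` is the translate by `−4` of the CM point `√−2` of `x² + 2y²`.
[folklore] -/
private theorem sl2z_smul_formTau_neg_eight :
    sl2zMk 1 (-4) 0 1 (by norm_num) • formTau ⟨1, 0, 2⟩ = cmTau (-8) := by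
  apply UpperHalfPlane.ext
  rw [coe_sl2zMk_smul, coe_cmTau (by norm_num), formTau, coe_heegnerTau (by norm_num) (by norm_num),
    cmGen]
  have h8 : ((4 : ℝ) * (1 : ℤ) * (2 : ℤ) - (0 : ℤ) ^ 2) = 8 := by norm_num
  have h8' : (-((-8 : ℤ) : ℝ)) = 8 := by norm_num
  rw [h8, h8']
  apply Complex.ext
  · simp
    norm_num
  · simp

/-- **`j(√−2) = 8000 = 20³`** at the CM point of `x² + 2y²`, from the tree's table of singular moduli
(`singularModuli_classNumberOne`, row `d = −8`). [cite: Cox2013, §12.C (12.20)] -/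
theorem kleinJ_formTau_neg_eight (h : singularModuli_classNumberOne) :
    kleinJ (formTau ⟨1, 0, 2⟩) = 8000 := by
  have hmem : (8000 : ℚ) ∈ maximalCMJInvariants := by simp [maximalCMJInvariants]
  have hrow := h _ hmem
  have hd : cmDiscr 8000 = -8 := by norm_num [cmDiscr]
  rw [hd, cmPeriodPair, ← kleinJ_eq_periodPair_j, ← sl2z_smul_formTau_neg_eight, kleinJ_smul] at hrow
  rw [hrow]
  push_cast
  ring

/-- `ε` at `2, 5, 7, 13` for `(d₁, d₂) = (−7, −8)`: `(−7/2) = 1`, `(−7/5) = −1`, `(−8/7) = −1` (`7 ∣ d₁`),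
`(−7/13) = −1`. [folklore] -/
private theorem eps_neg_seven_neg_eight :
    eps (-7) (-8) 2 = 1 ∧ eps (-7) (-8) 5 = -1 ∧ eps (-7) (-8) 7 = -1 ∧ eps (-7) (-8) 13 = -1 := by
  refine ⟨?_, ?_, ?_, ?_⟩
  · rw [eps_prime _ _ Nat.prime_two, epsPrime, if_neg (by decide), kroneckerPrime, if_pos rfl]
    decide
  · rw [eps_prime _ _ (by norm_num : Nat.Prime 5), epsPrime, if_neg (by decide), kroneckerPrime,
      if_neg (by decide)]
    norm_num
  · rw [eps_prime _ _ (by norm_num : Nat.Prime 7), epsPrime, if_pos (by decide), kroneckerPrime,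
      if_neg (by decide)]
    norm_num
  · rw [eps_prime _ _ (by norm_num : Nat.Prime 13), epsPrime, if_neg (by decide), kroneckerPrime,
      if_neg (by decide)]
    norm_num

/-- `F(14) = 2^{ε(7)} 7^{ε(2)} 14 = 49` and `F(10) = 2^{ε(5)} 5^{ε(2)} 10 = 25` for `(d₁, d₂) = (−7, −8)`.
[folklore] -/
private theorem F_neg_seven_neg_eight : F (-7) (-8) 14 = 49 ∧ F (-7) (-8) 10 = 25 := by
  obtain ⟨h2, h5, h7, -⟩ := eps_neg_seven_neg_eight
  refine ⟨?_, ?_⟩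
  · have hdiv : Nat.divisors 14 = {1, 2, 7, 14} := by decide
    rw [F, hdiv, Finset.prod_insert (by decide), Finset.prod_insert (by decide),
      Finset.prod_pair (by decide)]
    norm_num [h2, h7]
  · have hdiv : Nat.divisors 10 = {1, 2, 5, 10} := by decide
    rw [F, hdiv, Finset.prod_insert (by decide), Finset.prod_insert (by decide),
      Finset.prod_pair (by decide)]
    norm_num [h2, h5]

/-- The `x`-range for `(−7, −8)`: `x² < 56`, `x` even. [folklore] -/
private theorem xRange_neg_seven_neg_eight : xRange (-7) (-8) = {-6, -4, -2, 0, 2, 4, 6} := by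
  decide

/-- The right-hand side of Theorem 1.3 at `(d₁, d₂) = (−7, −8)`:
`∏ₓ F((56 − x²)/4) = F(5) F(10) F(13) F(14) F(13) F(10) F(5) = 5·25·13·49·13·25·5 = 129390625 = 11375²`
(evaluation of the printed right-hand side; all primes `≤ d₁d₂/4 = 14`).
[cite: GrossZagier1985SingularModuli, Theorem 1.3 (right-hand side at (−7, −8))] -/
theorem rhs_neg_seven_neg_eight : rhs (-7) (-8) = 129390625 := by
  obtain ⟨h14, h10⟩ := F_neg_seven_neg_eight
  rw [rhs, xRange_neg_seven_neg_eight, Finset.prod_insert (by decide), Finset.prod_insert (by decide),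
    Finset.prod_insert (by decide), Finset.prod_insert (by decide), Finset.prod_insert (by decide),
    Finset.prod_pair (by decide)]
  norm_num
  rw [show (5 : ℤ).toNat = 5 from rfl, show (10 : ℤ).toNat = 10 from rfl, show (13 : ℤ).toNat = 13 from rfl,
    show (14 : ℤ).toNat = 14 from rfl, h14, h10, F_prime _ _ (by norm_num : Nat.Prime 5),
    F_prime _ _ (by norm_num : Nat.Prime 13)]
  norm_num

/-- **Gross–Zagier Theorem 1.3 at `(d₁, d₂) = (−7, −8)`**: `J(−7,−8)^8 = (−11375)^8 = (11375²)^4 = (∏ₓ F)^{w₁w₂}`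
(`−15³ − 20³ = −5³·7·13`), from the singular-moduli table (rows `d = −7, −8`).
[cite: GrossZagier1985SingularModuli, Theorem 1.3] -/
theorem grossZagier1985_neg_seven_neg_eight (h : singularModuli_classNumberOne) :
    J (-7) (-8) ^ 8 = ((rhs (-7) (-8) : ℚ) : ℂ) ^ (unitCount (-7) * unitCount (-8)) := by
  rw [J, reducedFormsList_neg_seven, reducedFormsList_neg_eight, rhs_neg_seven_neg_eight,
    unitCount_of_ne (by norm_num) (by norm_num), unitCount_of_ne (by norm_num) (by norm_num)]
  simp [kleinJ_formTau_neg_seven h, kleinJ_formTau_neg_eight h]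
  norm_num

end GrossZagier1985

end Literature.NumberTheory.EllipticCurves
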